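import Summits.BirchSwinnertonDyer.BirchSwinnertonDyer.Theorems.CongruentShaFreeCutKatoZetaRoadPinnedH2
import Summits.BirchSwinnertonDyer.BirchSwinnertonDyer.Theorems.CongruentShaFreeCutKatoReadingsOfNontrivialH1
import Summits.BirchSwinnertonDyer.BirchSwinnertonDyer.Theorems.CongruentShaFreeCutKatoReading31b
import Literature.NumberTheory.EllipticCurves.Kato2004.LocPKernelRankOneProofs
import Literature.NumberTheory.EllipticCurves.Kato2004.IwasawaH1RankLowerBoundProofs
import HarnessLib

set_option linter.dupNamespace false
set_option autoImplicit false

/-! # Route `CongruentShaFreeCut` (rung S2) — crux B `AnalyticRankOneOfRankOneFiniteShaTwo`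
# (stmt-BirchSwinnertonDyer-19080) on the pinned Kato–zeta / Perrin-Riou road: THE CENSUS AFTER (α), (R1), (R2) —
# crux B ⟸ six refereed theorems ∧ «`𝐇¹_Γ(T₂E_n) ≠ 0`» ∧ Perrin-Riou's formula `PRFormulaAtTwoH2`

Cell `bsd-cn100`, prover seat `bsd-cn100-s2-c3` (g12; §4 appended by g14 after the v1h input
`Kato2004.one_le_rank_iwasawaH1` — `Kato2004/IwasawaH1RankLowerBound.lean`, p516793 — and its companion proofs
`Kato2004/IwasawaH1RankLowerBoundProofs.lean`, p517993, landed). Supports, does not close, stmt-BirchSwinnertonDyer-19080;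
concludes the crux BY NAME (so it may import the `Theses` cone, standing build rule (H)). THEOREMS ONLY.
PARTITION: none — RANK axis.

## What is proved

The registered line `kato-zeta-perrin-riou` v1g reads: crux B ⟸ `stub_refereedInputs` (RI7 = six refereed
theorems ∧ `Kato2004.thm12_4`) ∧ `stub_prFormulaAtTwo : PRFormulaAtTwoH2`, through the landed census
`CongruentShaFreeCutKatoZetaRoadPinnedH2.cruxB_of_prFormulaH2_of_readings` whose reading `hRK` is asked for
EVERY square-free `n`. Here:

* `heegnerNonTorsionAtTwo_of_prFormulaH2_of_readings_rankOne`, `cruxB_of_prFormulaH2_of_readings_rankOne` —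
  the SAME compositions with `hRK` asked only UNDER THE CRUX HYPOTHESES (`rank E_n(ℚ) = 1`, `#Ш(E_n)[2^∞] < ∞`);
  the landed proof uses `hRK` only after these are in context, so the text is that proof verbatim with
  `hRK hsq` ↦ `hRK hsq hrank hsha`.
* **`cruxB_of_refereed_of_nontrivialH1_of_prFormulaH2` — THE CENSUS:** crux B ⟸ the six refereed theorems
  (2-parity, modularity, Hoffstein–Luo, Kato's finiteness theorem, Heegner points over `K`, Gross–Zagier +
  Kolyvagin) ∧ (NT) «`𝐇¹_Γ(T_pW) ≠ 0` at every cyclotomic pin» ∧ `PRFormulaAtTwoH2` — the readings being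
  THEOREMS from (NT): `readingRK_congruentNumberCurve_of_nontrivial`, `reading31_of_nontrivial`
  (`CongruentShaFreeCutKatoReadingsOfNontrivialH1`, this seat g12, over (α) p510488, (R1) p508547, (R2)
  p514042, (12.2.1), torsion-freeness) and `reading31b_two_of_fact locP_kernel_isTorsion_of_rankOne_holds`.
* `cruxB_of_refereed_of_nontrivialH1_rankOne_of_prFormulaH2` — the same with (NT) asked only for the curves
  `E_n`, `n` square-free, of rank one with finite `Ш[2^∞]`, at `p = 2` (NT′₂): the SHARPEST statement of
  what the road consumes of Kato Thm. 12.4.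
* `cruxB_of_refereed_of_thm12_4_of_prFormulaH2` — RI7 ∧ PR₂ ⟹ crux B through the new door
  (`Kato2004.nontrivial_iwasawaH1_of_thm12_4`), i.e. the registered (v1g) skeleton's content re-derived.
* §4 (g14, RI7′ currency of the registered v1h line 21ecf8dd…): `cruxB_of_refereed_of_oneLeRank_of_prFormulaH2`
  (six refereed ∧ the NAMED FACT `Kato2004.one_le_rank_iwasawaH1` ∧ PR₂ ⟹ crux B), **`cruxB_of_RI7prime_of_prFormulaH2`**
  (hypotheses = token for token the two REGISTERED v1h stub signatures: the tree-side certificate that the registered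
  stubs are jointly sufficient for crux B BY NAME), `cruxB_of_refereed_of_oneLeRank_rankOne_of_prFormulaH2` (sharpest).

NUMBERS on this road after this file: crux B = 6 refereed theorems + 1 displayed Kato input («`𝐇¹ ≠ 0`» ⟺
«`1 ≤ rank_Λ 𝐇¹`» at a pin, `Kato2004.nontrivial_iwasawaH1_iff_one_le_rank`: the Euler-system-free INEQUALITY half of
Kato's Euler–Poincaré identity (12.2.2) — Tate 1966 / Perrin-Riou 1995; Greenberg LNM 1716 §4 at `p = 2` — i.e. the
LOWER bound in Thm. 12.4 (2); Kato's zeta elements and Rohrlich's non-vanishing enter Thm. 12.4 (1), the UPPER bound,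
which this road does not cite but REPLACES by the tree theorems (R1)/(R2) under crux B's hypotheses) + 1 OPEN formula
(Perrin-Riou at the additive prime `2`, `PRFormulaAtTwoH2`, 0 sources). HONEST FRAMING: (NT) /
`one_le_rank_iwasawaH1` and `PRFormulaAtTwoH2` are displayed hypotheses; nothing about them, crux B, the leaf
`rankOne_twoConverse_congruentNumber`, the congruent number problem or BSD is proved; no item closes.

References: [AlpogeBhargavaShnidman2022] App. A (Burungale–Skinner) Thm. 10.1, §10.1.3, Thm. 10.6, Thm. 10.8;
[Kato2004Asterisque] Thm. 12.4, Thm. 12.5, §14.14, Cor. 14.3; [BurungaleTian2026] Thm. 2.6, Thm. 3.1;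
[GrossZagier1986] Thm. I.6.3.
-/

noncomputable section

open scoped Classical

open WeierstrassCurve NumberField IsDedekindDomain Field Literature.NumberTheory.EllipticCurves
  Literature.NumberTheory.EllipticCurves.Rank1Residual Literature.NumberTheory.EllipticCurves.Kato2004
  Literature.NumberTheory.EllipticCurves.Kato2004.EulerSystemValues Literature.NumberTheory.EllipticCurves.Castella2018
  Literature.NumberTheory.GaloisRepresentations
  Summit.BirchSwinnertonDyer.Rank1Residual.Additive
  Summit.BirchSwinnertonDyer.BirchSwinnertonDyer.Theses.CongruentShaFreeCut
  Summit.BirchSwinnertonDyer.BirchSwinnertonDyer.Theorems.CongruentShaFreeCutKatoDescentDatumOfH2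
  Summit.BirchSwinnertonDyer.BirchSwinnertonDyer.Theorems.CongruentShaFreeCutKatoZetaRoadPinnedH2
open Summit.BirchSwinnertonDyer.BirchSwinnertonDyer.Theorems.CongruentShaFreeCutOfHeegnerNonTorsion
  (HeegnerNonTorsionAtTwo analyticRankOne_of_facts_of_heegnerNonTorsion)
open Summit.BirchSwinnertonDyer.BirchSwinnertonDyer.Theorems.CongruentShaFreeCutKatoReadingsOfNontrivialH1
open Summit.BirchSwinnertonDyer.BirchSwinnertonDyer.Theorems.CongruentShaFreeCutKatoReading31b (reading31b_two_of_fact)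

namespace Summit.BirchSwinnertonDyer.BirchSwinnertonDyer.Theorems.CongruentShaFreeCutKatoZetaRoadNontrivialH1

/-! ## §1 The pinned-road compositions with (R+K) asked only under the crux hypotheses -/

/-- **Heegner points of `E_n` are non-torsion at a rank-one `Ш[2^∞]`-finite datum, on the pinned Kato–zeta
road — (R+K) asked only under the crux hypotheses.** Verbatim the landed
`CongruentShaFreeCutKatoZetaRoadPinnedH2.heegnerNonTorsionAtTwo_of_prFormulaH2_of_readings` (s2-c3 g7) with
`hRK` carrying `mordellWeilRank = 1 → Finite Ш[2^∞] →` (used as `hRK hsq hrank hsha`). CONDITIONAL on the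
displayed hypotheses; credits nothing.
[cite: AlpogeBhargavaShnidman2022, App. A Thm. 10.1, Thm. 10.6, Thm. 10.8, §10.1.3 (pp. 33–34)]
[cite: BurungaleTian2026, Thm. 2.6 and Thm. 3.1] [cite: Kato2004Asterisque, Thm. 12.4, Conj. 12.10, §14.14, Cor. 14.3] -/
theorem heegnerNonTorsionAtTwo_of_prFormulaH2_of_readings_rankOne
    (hKato : ∀ (W : WeierstrassCurve ℚ) [W.IsElliptic] (p : ℕ) [Fact p.Prime],
      kato_finite_of_L_one_ne_zero W p)
    (hRK : ∀ ⦃n : ℕ⦄, Squarefree n →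
      ∀ [(congruentNumberCurve n).IsElliptic] [(congruentNumberCurve n).IsGloballyMinimal]
        [ContinuousSMul ℤ_[2] ((congruentNumberCurve n).tateModule 2)],
        (congruentNumberCurve n).mordellWeilRank = 1 →
          Finite (AddCommGroup.primaryComponent (congruentNumberCurve n).sha 2) →
        ∃ D : KatoDescentDatum 2, Nonempty (KatoDescentDatumPinH2 (congruentNumberCurve n) 2 D) ∧
          ∃ a b : ℕ,
            Ideal.span {((2 : ℕ) : IwasawaAlgebra 2) ^ a} * Module.charIdeal (IwasawaAlgebra 2) D.H2 =
              Ideal.span {((2 : ℕ) : IwasawaAlgebra 2) ^ b} *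
                Module.charIdeal (IwasawaAlgebra 2) (D.H ⧸ (IwasawaAlgebra 2) ∙ D.z))
    (h31 : ∀ ⦃n : ℕ⦄, Squarefree n →
      ∀ [(congruentNumberCurve n).IsElliptic] [(congruentNumberCurve n).IsGloballyMinimal]
        [ContinuousSMul ℤ_[2] ((congruentNumberCurve n).tateModule 2)]
        (D : KatoDescentDatum 2), Nonempty (KatoDescentDatumPinH2 (congruentNumberCurve n) 2 D) →
        (congruentNumberCurve n).mordellWeilRank = 1 →
          Finite (AddCommGroup.primaryComponent (congruentNumberCurve n).sha 2) →
            Finite (IwasawaAlgebra.coinvariants 2 D.H2))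
    (h31b : ∀ ⦃n : ℕ⦄, Squarefree n →
      ∀ [(congruentNumberCurve n).IsElliptic] [(congruentNumberCurve n).IsGloballyMinimal]
        [ContinuousSMul ℤ_[2] ((congruentNumberCurve n).tateModule 2)]
        (D : KatoDescentDatum 2) (pin : KatoDescentDatumPinH2 (congruentNumberCurve n) 2 D),
        (congruentNumberCurve n).mordellWeilRank = 1 →
          Finite (AddCommGroup.primaryComponent (congruentNumberCurve n).sha 2) →
            (∀ m : ℕ, 2 ^ m • D.ι (Submodule.Quotient.mk D.z) ≠ 0) →
              ∀ t : ℚ_[2], HasLocPKummerLog (congruentNumberCurve n) 2 pin.katoClass t → t ≠ 0)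
    (hPR : PRFormulaAtTwoH2) :
    HeegnerNonTorsionAtTwo := by
  intro n hsq K _ _ N _ hN hK hHN hH2 hLK hrank hsha P hP hPtor
  haveI := isElliptic_congruentNumberCurve hsq.ne_zero
  haveI := isGloballyMinimal_congruentNumberCurve hsq
  haveI : ContinuousSMul ℤ_[2] ((congruentNumberCurve n).tateModule 2) :=
    TateModule.continuousSMul_padicInt
  -- an embedding `ι : K → ℚ₂` at a degree-one prime over `2` (`2` splits in `K`)
  obtain ⟨-, -, 𝔭, -, -, h𝔭, he, hf⟩ :=
    Summit.BirchSwinnertonDyer.Rank1Residual.X11b.exists_anticyclotomic_generator_degreeOnePrime 2 K hK hH2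
  set ι : K →+* ℚ_[2] := Summit.BirchSwinnertonDyer.Rank1Residual.X11b.embAt K 2 𝔭 h𝔭 he hf with hιdef
  -- rank one ⟹ `L(E_n, 1) = 0` (Kato's finiteness theorem)
  have hL : (congruentNumberCurve n).entireLFunction 1 = 0 :=
    CongruentShaFreeCutKatoZetaRoad.entireLFunction_one_eq_zero_of_mordellWeilRank_eq_one
      (congruentNumberCurve n) 2 (hKato _ 2) hrank
  -- the pinned datum with the char-ideal relation (asked only now, under the crux hypotheses)
  obtain ⟨D, ⟨pin⟩, hMC⟩ := hRK hsq hrank hsha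
  have hz : ∀ m : ℕ, 2 ^ m • D.ι (Submodule.Quotient.mk D.z) ≠ 0 :=
    KatoZeta.forall_pow_smul_iota_zeta_ne_zero D hMC (h31 hsq D ⟨pin⟩ hrank hsha)
  -- Perrin-Riou's formula at `ι`, `P`, and the pinned datum
  obtain ⟨c, hc, hPRx⟩ := hPR hsq K N hN hK hHN hH2 hLK ι P hP hL D pin hMC
  have ht : c * padicLogOmega (congruentNumberCurve n) 2 ι P ^ 2 ≠ 0 :=
    h31b hsq D pin hrank hsha hz _ hPRx
  -- but a torsion Heegner point has `log_ω(P) = 0`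
  have hlog : padicLogOmega (congruentNumberCurve n) 2 ι P = 0 := by
    unfold padicLogOmega
    rw [AcPConverseLinks.padicLogPoint_formalIndex_smul_eq_zero_of_isOfFinAddOrder
      (congruentNumberCurve n) 2 ι hPtor, zero_div]
  exact ht (by rw [hlog, zero_pow two_ne_zero, mul_zero])

/-- **Crux B on the pinned Kato–zeta road, (R+K) asked only under the crux hypotheses**: the landed
`cruxB_of_prFormulaH2_of_readings` with the weakened `hRK`; proof
`analyticRankOne_of_facts_of_heegnerNonTorsion ∘ heegnerNonTorsionAtTwo_of_prFormulaH2_of_readings_rankOne`.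
CONDITIONAL; closes nothing.
[cite: AlpogeBhargavaShnidman2022, App. A Thm. 10.1, Rem. 10.5 (i), Thm. 10.6, Thm. 10.8, §10.1.3]
[cite: GrossZagier1986, Thm. I.6.3 with V.§2] [cite: Kato2004Asterisque, Cor. 14.3, §14.14] -/
theorem cruxB_of_prFormulaH2_of_readings_rankOne
    (hpar : ∀ (W : WeierstrassCurve ℚ) [W.IsElliptic] (p : ℕ) [Fact p.Prime], p_parity W p)
    (hmod : ModularForms.exists_isNewformOf) (hHL : HoffsteinLuo1997_exists_twist_L_one_ne_zero)
    (hKato : ∀ (W : WeierstrassCurve ℚ) [W.IsElliptic] (p : ℕ) [Fact p.Prime],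
      kato_finite_of_L_one_ne_zero W p)
    (hHP : ∀ (W : WeierstrassCurve ℚ) (K : Type) [Field K] [NumberField K],
      exists_isHeegnerPoint W K)
    (hGZ : ∀ (W : WeierstrassCurve ℚ) (N : ℕ) [NeZero N] (K : Type) [Field K] [NumberField K],
      analyticRankEK_eq_one_iff_heegner_nonTorsion W N K)
    (hRK : ∀ ⦃n : ℕ⦄, Squarefree n →
      ∀ [(congruentNumberCurve n).IsElliptic] [(congruentNumberCurve n).IsGloballyMinimal]
        [ContinuousSMul ℤ_[2] ((congruentNumberCurve n).tateModule 2)],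
        (congruentNumberCurve n).mordellWeilRank = 1 →
          Finite (AddCommGroup.primaryComponent (congruentNumberCurve n).sha 2) →
        ∃ D : KatoDescentDatum 2, Nonempty (KatoDescentDatumPinH2 (congruentNumberCurve n) 2 D) ∧
          ∃ a b : ℕ,
            Ideal.span {((2 : ℕ) : IwasawaAlgebra 2) ^ a} * Module.charIdeal (IwasawaAlgebra 2) D.H2 =
              Ideal.span {((2 : ℕ) : IwasawaAlgebra 2) ^ b} *
                Module.charIdeal (IwasawaAlgebra 2) (D.H ⧸ (IwasawaAlgebra 2) ∙ D.z))
    (h31 : ∀ ⦃n : ℕ⦄, Squarefree n →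
      ∀ [(congruentNumberCurve n).IsElliptic] [(congruentNumberCurve n).IsGloballyMinimal]
        [ContinuousSMul ℤ_[2] ((congruentNumberCurve n).tateModule 2)]
        (D : KatoDescentDatum 2), Nonempty (KatoDescentDatumPinH2 (congruentNumberCurve n) 2 D) →
        (congruentNumberCurve n).mordellWeilRank = 1 →
          Finite (AddCommGroup.primaryComponent (congruentNumberCurve n).sha 2) →
            Finite (IwasawaAlgebra.coinvariants 2 D.H2))
    (h31b : ∀ ⦃n : ℕ⦄, Squarefree n →
      ∀ [(congruentNumberCurve n).IsElliptic] [(congruentNumberCurve n).IsGloballyMinimal]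
        [ContinuousSMul ℤ_[2] ((congruentNumberCurve n).tateModule 2)]
        (D : KatoDescentDatum 2) (pin : KatoDescentDatumPinH2 (congruentNumberCurve n) 2 D),
        (congruentNumberCurve n).mordellWeilRank = 1 →
          Finite (AddCommGroup.primaryComponent (congruentNumberCurve n).sha 2) →
            (∀ m : ℕ, 2 ^ m • D.ι (Submodule.Quotient.mk D.z) ≠ 0) →
              ∀ t : ℚ_[2], HasLocPKummerLog (congruentNumberCurve n) 2 pin.katoClass t → t ≠ 0)
    (hPR : PRFormulaAtTwoH2) :
    AnalyticRankOneOfRankOneFiniteShaTwo :=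
  analyticRankOne_of_facts_of_heegnerNonTorsion hpar hmod hHL hKato hHP hGZ
    (heegnerNonTorsionAtTwo_of_prFormulaH2_of_readings_rankOne hKato hRK h31 h31b hPR)

/-! ## §2 THE CENSUS: crux B ⟸ six refereed theorems ∧ «𝐇¹_Γ ≠ 0» ∧ `PRFormulaAtTwoH2` -/

/-- **CENSUS (after (α), (R1), (R2)).** Crux B `AnalyticRankOneOfRankOneFiniteShaTwo` follows from the six
refereed theorems of the line of record, the ONE displayed Kato input
(NT) «`𝐇¹_Γ(T_pW) ≠ 0` at every cyclotomic pin» (the LOWER bound in Kato Thm. 12.4 (2) = the Euler-system-free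
inequality half `1 ≤ rank_Λ 𝐇¹` of the Euler–Poincaré identity (12.2.2) — Tate 1966 / Perrin-Riou 1995; Greenberg
LNM 1716 §4 at `p = 2` —; implied by the RI conjunct `thm12_4` and, in the rank currency, the body of the named fact
`Kato2004.one_le_rank_iwasawaH1` (§4); Kato's zeta elements / Rohrlich enter Thm. 12.4 (1) = the UPPER bound, which
this road replaces by (R1)/(R2) under the crux hypotheses), and the research statement `PRFormulaAtTwoH2`. All three
readings of the road are THEOREMS from (NT):
`readingRK_congruentNumberCurve_of_nontrivial`, `reading31_of_nontrivial` (over (α) p510488, (12.2.1),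
torsion-freeness, (R1) p508547, (R2) p514042) and `reading31b_two_of_fact locP_kernel_isTorsion_of_rankOne_holds`
(p484260). CONDITIONAL on the displayed hypotheses; closes nothing; BSD is not proved by any of this.
[cite: Kato2004Asterisque, §12.2 (12.2.2) (p. 220), Thm. 12.4 (2) (p. 221), §14.14 (14.14.1) (p. 243), Cor. 14.3]
[cite: AlpogeBhargavaShnidman2022, App. A Thm. 10.1, Thm. 10.6, Thm. 10.8, §10.1.3 (pp. 33–34)] -/
theorem cruxB_of_refereed_of_nontrivialH1_of_prFormulaH2
    (hpar : ∀ (W : WeierstrassCurve ℚ) [W.IsElliptic] (p : ℕ) [Fact p.Prime], p_parity W p)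
    (hmod : ModularForms.exists_isNewformOf) (hHL : HoffsteinLuo1997_exists_twist_L_one_ne_zero)
    (hKato : ∀ (W : WeierstrassCurve ℚ) [W.IsElliptic] (p : ℕ) [Fact p.Prime],
      kato_finite_of_L_one_ne_zero W p)
    (hHP : ∀ (W : WeierstrassCurve ℚ) (K : Type) [Field K] [NumberField K],
      exists_isHeegnerPoint W K)
    (hGZ : ∀ (W : WeierstrassCurve ℚ) (N : ℕ) [NeZero N] (K : Type) [Field K] [NumberField K],
      analyticRankEK_eq_one_iff_heegner_nonTorsion W N K)
    (hNT : ∀ (W : WeierstrassCurve ℚ) [W.IsElliptic] (p : ℕ) [Fact p.Prime]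
      [ContinuousSMul ℤ_[p] (W.tateModule p)] (κ : ZpExtension ℚ p) (γ : absoluteGaloisGroup ℚ),
      κ.IsCyclotomic → κ.IsTopGenerator γ → ∀ I : IwasawaH1Data W p κ γ, Nontrivial I.H)
    (hPR : PRFormulaAtTwoH2) :
    AnalyticRankOneOfRankOneFiniteShaTwo :=
  cruxB_of_prFormulaH2_of_readings_rankOne hpar hmod hHL hKato hHP hGZ
    (readingRK_congruentNumberCurve_of_nontrivial hNT) (reading31_of_nontrivial hNT)
    (reading31b_two_of_fact locP_kernel_isTorsion_of_rankOne_holds) hPR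

/-- **RI7 ∧ PR₂ ⟹ crux B THROUGH THE NEW DOOR** — the content of the registered v1g skeleton re-derived:
`thm12_4` enters only via `Kato2004.nontrivial_iwasawaH1_of_thm12_4` (so of Kato Thm. 12.4 the line consumes
exactly «`𝐇¹_Γ ≠ 0`»). Argument order = the registered `stub_refereedInputs` conjuncts, then `PRFormulaAtTwoH2`.
[cite: Kato2004Asterisque, Thm. 12.4 (p. 221) and §14.14 (p. 243)] [cite: AlpogeBhargavaShnidman2022, App. A Thm. 10.8 and §10.1.3] -/
theorem cruxB_of_refereed_of_thm12_4_of_prFormulaH2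
    (hpar : ∀ (W : WeierstrassCurve ℚ) [W.IsElliptic] (p : ℕ) [Fact p.Prime], p_parity W p)
    (hmod : ModularForms.exists_isNewformOf) (hHL : HoffsteinLuo1997_exists_twist_L_one_ne_zero)
    (hKato : ∀ (W : WeierstrassCurve ℚ) [W.IsElliptic] (p : ℕ) [Fact p.Prime],
      kato_finite_of_L_one_ne_zero W p)
    (hHP : ∀ (W : WeierstrassCurve ℚ) (K : Type) [Field K] [NumberField K],
      exists_isHeegnerPoint W K)
    (hGZ : ∀ (W : WeierstrassCurve ℚ) (N : ℕ) [NeZero N] (K : Type) [Field K] [NumberField K],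
      analyticRankEK_eq_one_iff_heegner_nonTorsion W N K)
    (h12 : thm12_4) (hPR : PRFormulaAtTwoH2) :
    AnalyticRankOneOfRankOneFiniteShaTwo :=
  cruxB_of_refereed_of_nontrivialH1_of_prFormulaH2 hpar hmod hHL hKato hHP hGZ
    (nontrivial_iwasawaH1_of_thm12_4 h12) hPR

/-! ## §3 The sharpest form: «𝐇¹_Γ(T₂E_n) ≠ 0» only for the rank-one `Ш[2^∞]`-finite curves `E_n` -/

/-- **(3.1′) at a v2 pin of `E_n` from the CRUX-LOCAL non-vanishing (NT′₂).** For square-free `n` with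
`rank E_n(ℚ) = 1`, `#Ш(E_n)[2^∞] < ∞` and a pin with `𝐇¹_Γ ≠ 0` at THAT pin: `D.H2/T·D.H2` is finite —
`IwasawaH1Data.finite_descentCokernel_of_rank_le_one` ((α)-door `TwistTate.mem_TSubmodule_of_proj_zero_eq_zero`,
(R1) `rank_integralH1_layerZero_le_one`) transported by `finite_descentCokernel_iff_finite_coinvariants_H2`
and `coinvariantsEquiv pin.eH2`. [cite: Kato2004Asterisque, §14.14 (14.14.1)–(14.14.2) (p. 243) and (14.9.3) (p. 240)] -/
theorem reading31_of_nontrivial_rankOne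
    (hNT : ∀ ⦃n : ℕ⦄, Squarefree n →
      ∀ [(congruentNumberCurve n).IsElliptic] [ContinuousSMul ℤ_[2] ((congruentNumberCurve n).tateModule 2)]
        (κ : ZpExtension ℚ 2) (γ : absoluteGaloisGroup ℚ), κ.IsCyclotomic → κ.IsTopGenerator γ →
        ∀ I : IwasawaH1Data (congruentNumberCurve n) 2 κ γ,
          (congruentNumberCurve n).mordellWeilRank = 1 →
            Finite (AddCommGroup.primaryComponent (congruentNumberCurve n).sha 2) → Nontrivial I.H) :
    ∀ ⦃n : ℕ⦄, Squarefree n →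
      ∀ [(congruentNumberCurve n).IsElliptic] [(congruentNumberCurve n).IsGloballyMinimal]
        [ContinuousSMul ℤ_[2] ((congruentNumberCurve n).tateModule 2)]
        (D : KatoDescentDatum 2), Nonempty (KatoDescentDatumPinH2 (congruentNumberCurve n) 2 D) →
        (congruentNumberCurve n).mordellWeilRank = 1 →
          Finite (AddCommGroup.primaryComponent (congruentNumberCurve n).sha 2) →
            Finite (IwasawaAlgebra.coinvariants 2 D.H2) := by
  intro n hsq _ _ _ D hpin hrank hsha
  obtain ⟨pin⟩ := hpin
  haveI := IwasawaH1Data.module_finite_of_isCyclotomic pin.isCyclotomic pin.isTopGenerator pin.I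
  haveI := pin.I.isTorsionFree pin.isTopGenerator
  haveI : Nontrivial pin.I.H := hNT hsq pin.κ pin.γ pin.isCyclotomic pin.isTopGenerator pin.I hrank hsha
  haveI := hsha
  have hfin : Finite pin.I.descentCokernel :=
    pin.I.finite_descentCokernel_of_rank_le_one
      (fun x hx ↦ TwistTate.mem_TSubmodule_of_proj_zero_eq_zero (congruentNumberCurve n) 2 pin.κ
        pin.isCyclotomic pin.isTopGenerator pin.I x hx)
      (CongruentShaFreeCutIntegralH1RankLeOne.rank_integralH1_layerZero_le_one (congruentNumberCurve n) 2
        pin.κ hrank)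
  haveI : Finite (IwasawaAlgebra.coinvariants 2 pin.J.H2) :=
    pin.J.finite_descentCokernel_iff_finite_coinvariants_H2.mp hfin
  exact Finite.of_equiv _ (IwasawaAlgebra.coinvariantsEquiv pin.eH2).toEquiv.symm

/-- **CENSUS, SHARPEST FORM.** Crux B ⟸ the six refereed theorems ∧ (NT′₂) «for every square-free `n` with
`rank E_n(ℚ) = 1` and `#Ш(E_n)[2^∞] < ∞`, `𝐇¹_Γ(T₂E_n) ≠ 0` at the cyclotomic `ℤ₂`-pins» ∧ `PRFormulaAtTwoH2`.
(NT′₂) is the existence of ONE non-zero norm-compatible family of classes in `lim← H¹(ℤ_m[1/2], T₂E_n)` up the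
cyclotomic `ℤ₂`-tower — in Kato's text the Euler-system-free consequence `1 ≤ rank_Λ 𝐇¹` of the Euler–Poincaré
identity (12.2.2) (Tate 1966 / Perrin-Riou 1995; Greenberg LNM 1716 §4 at `p = 2`), the LOWER bound in Thm. 12.4 (2);
NOT the zeta elements, which give Thm. 12.4 (1) = the UPPER bound, replaced on this road by (R1)/(R2). Rank-currency
twin: `cruxB_of_refereed_of_oneLeRank_rankOne_of_prFormulaH2` (§4).
CONDITIONAL; closes nothing. [cite: Kato2004Asterisque, §12.2 (12.2.2) (p. 220), Thm. 12.4 (2) (p. 221), §14.14 (p. 243)]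
[cite: AlpogeBhargavaShnidman2022, App. A Thm. 10.1, Thm. 10.8, §10.1.3 (pp. 33–34)] -/
theorem cruxB_of_refereed_of_nontrivialH1_rankOne_of_prFormulaH2
    (hpar : ∀ (W : WeierstrassCurve ℚ) [W.IsElliptic] (p : ℕ) [Fact p.Prime], p_parity W p)
    (hmod : ModularForms.exists_isNewformOf) (hHL : HoffsteinLuo1997_exists_twist_L_one_ne_zero)
    (hKato : ∀ (W : WeierstrassCurve ℚ) [W.IsElliptic] (p : ℕ) [Fact p.Prime],
      kato_finite_of_L_one_ne_zero W p)
    (hHP : ∀ (W : WeierstrassCurve ℚ) (K : Type) [Field K] [NumberField K],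
      exists_isHeegnerPoint W K)
    (hGZ : ∀ (W : WeierstrassCurve ℚ) (N : ℕ) [NeZero N] (K : Type) [Field K] [NumberField K],
      analyticRankEK_eq_one_iff_heegner_nonTorsion W N K)
    (hNT : ∀ ⦃n : ℕ⦄, Squarefree n →
      ∀ [(congruentNumberCurve n).IsElliptic] [ContinuousSMul ℤ_[2] ((congruentNumberCurve n).tateModule 2)]
        (κ : ZpExtension ℚ 2) (γ : absoluteGaloisGroup ℚ), κ.IsCyclotomic → κ.IsTopGenerator γ →
        ∀ I : IwasawaH1Data (congruentNumberCurve n) 2 κ γ,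
          (congruentNumberCurve n).mordellWeilRank = 1 →
            Finite (AddCommGroup.primaryComponent (congruentNumberCurve n).sha 2) → Nontrivial I.H)
    (hPR : PRFormulaAtTwoH2) :
    AnalyticRankOneOfRankOneFiniteShaTwo :=
  cruxB_of_prFormulaH2_of_readings_rankOne hpar hmod hHL hKato hHP hGZ
    (readingRK_congruentNumberCurve_of_nontrivial_rankOne hNT) (reading31_of_nontrivial_rankOne hNT)
    (reading31b_two_of_fact locP_kernel_isTorsion_of_rankOne_holds) hPR

/-! ## §4 RI7′ currency (the registered v1h line): crux B ⟸ six refereed theorems ∧ `Kato2004.one_le_rank_iwasawaH1` ∧ `PRFormulaAtTwoH2`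

Written after the v1h input `Kato2004.one_le_rank_iwasawaH1` (p516793: «`1 ≤ rank_Λ 𝐇¹_Γ(T_pW)` at every cyclotomic
pin», Kato (12.2.2)'s Euler-system-free inequality half; RI7 ⟹ RI7′ by `one_le_rank_iwasawaH1_of_thm12_4`, p517993)
landed and the plan's act (xv) registered the v1h skeleton (21ecf8dd…) on stmt-BirchSwinnertonDyer-19080. S2b twins:
`MordellShaFreeCutKatoZetaRoadNontrivialH1.cruxB_of_sixFacts_of_oneLeRank_of_prFormulaH2` / `cruxB_of_RI7prime_…` (p516726). -/

/-- **CENSUS in the RI7′ currency.** Crux B `AnalyticRankOneOfRankOneFiniteShaTwo` follows from the six refereed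
theorems of the line of record, the NAMED FACT `Kato2004.one_le_rank_iwasawaH1` («`1 ≤ rank_Λ 𝐇¹_Γ(T_pW)` at every
cyclotomic pin» — Kato (12.2.2)'s Euler-system-free inequality half, Tate 1966 / Perrin-Riou 1995, Greenberg LNM 1716
§4 at `p = 2`; the LOWER bound in Thm. 12.4 (2)) and the research statement `PRFormulaAtTwoH2`: the fact gives (NT)
(`Kato2004.nontrivial_of_one_le_rank_iwasawaH1`, p517993) and `cruxB_of_refereed_of_nontrivialH1_of_prFormulaH2`
concludes. The UPPER bound of Thm. 12.4 (where Kato's zeta elements and Rohrlich enter) is not used: the road takes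
`rank_Λ 𝐇¹ ≤ 1` from (R1)/(R2) under the crux hypotheses. Argument order = the registered RI7′ conjuncts, then PR₂.
CONDITIONAL on the displayed hypotheses; closes nothing; BSD is not proved by any of this.
[cite: Kato2004Asterisque, §12.2 (12.2.2) (p. 220), Thm. 12.4 (2) (p. 221), §14.14 (14.14.1) (p. 243), Cor. 14.3]
[cite: AlpogeBhargavaShnidman2022, App. A Thm. 10.1, Thm. 10.6, Thm. 10.8, §10.1.3 (pp. 33–34)] -/
theorem cruxB_of_refereed_of_oneLeRank_of_prFormulaH2
    (hpar : ∀ (W : WeierstrassCurve ℚ) [W.IsElliptic] (p : ℕ) [Fact p.Prime], p_parity W p)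
    (hmod : ModularForms.exists_isNewformOf) (hHL : HoffsteinLuo1997_exists_twist_L_one_ne_zero)
    (hKato : ∀ (W : WeierstrassCurve ℚ) [W.IsElliptic] (p : ℕ) [Fact p.Prime],
      kato_finite_of_L_one_ne_zero W p)
    (hHP : ∀ (W : WeierstrassCurve ℚ) (K : Type) [Field K] [NumberField K],
      exists_isHeegnerPoint W K)
    (hGZ : ∀ (W : WeierstrassCurve ℚ) (N : ℕ) [NeZero N] (K : Type) [Field K] [NumberField K],
      analyticRankEK_eq_one_iff_heegner_nonTorsion W N K)
    (h1 : one_le_rank_iwasawaH1) (hPR : PRFormulaAtTwoH2) :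
    AnalyticRankOneOfRankOneFiniteShaTwo :=
  cruxB_of_refereed_of_nontrivialH1_of_prFormulaH2 hpar hmod hHL hKato hHP hGZ
    (nontrivial_of_one_le_rank_iwasawaH1 h1) hPR

/-- **Crux B from the BUNDLED RI7′ and the research statement — the registered v1h skeleton's `_of_stubs` as a tree
theorem.** The hypothesis `RI` is, token for token, the registered signature of `stub_refereedInputs` (six refereed
theorems — 2-parity, modularity, Hoffstein–Luo, Kato's finiteness theorem, Heegner points over `K`, Gross–Zagier +
Kolyvagin — ∧ `Kato2004.one_le_rank_iwasawaH1`), and `hPR` that of `stub_prFormulaAtTwo`; so this theorem is the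
kernel certificate, in the tree, that the two registered stubs of the line `kato-zeta-perrin-riou` v1h are jointly
sufficient for crux B BY NAME. CONDITIONAL; closes nothing; nothing about the seven citation-borne inputs or
`PRFormulaAtTwoH2` is proved here.
[cite: Kato2004Asterisque, §12.2 (12.2.2) (p. 220), Thm. 12.4 (2) (p. 221), Cor. 14.3]
[cite: DokchitserDokchitserAnnals2010, Thm. 1.4] [cite: GrossZagier1986, Thm. I.6.3 with V.§2] [cite: Gross1984, §§3–4]
[cite: AlpogeBhargavaShnidman2022, App. A Thm. 10.1, Thm. 10.8, §10.1.3 (pp. 33–34)] -/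
theorem cruxB_of_RI7prime_of_prFormulaH2
    (RI : (∀ (W : WeierstrassCurve ℚ) [W.IsElliptic] (p : ℕ) [Fact p.Prime], p_parity W p) ∧
      ModularForms.exists_isNewformOf ∧
      HoffsteinLuo1997_exists_twist_L_one_ne_zero ∧
      (∀ (W : WeierstrassCurve ℚ) [W.IsElliptic] (p : ℕ) [Fact p.Prime],
        kato_finite_of_L_one_ne_zero W p) ∧
      (∀ (W : WeierstrassCurve ℚ) (K : Type) [Field K] [NumberField K], exists_isHeegnerPoint W K) ∧
      (∀ (W : WeierstrassCurve ℚ) (N : ℕ) [NeZero N] (K : Type) [Field K] [NumberField K],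
        analyticRankEK_eq_one_iff_heegner_nonTorsion W N K) ∧
      one_le_rank_iwasawaH1)
    (hPR : PRFormulaAtTwoH2) :
    AnalyticRankOneOfRankOneFiniteShaTwo :=
  cruxB_of_refereed_of_oneLeRank_of_prFormulaH2 RI.1 RI.2.1 RI.2.2.1 RI.2.2.2.1 RI.2.2.2.2.1
    RI.2.2.2.2.2.1 RI.2.2.2.2.2.2 hPR

/-- **CENSUS, SHARPEST FORM, rank currency.** Crux B ⟸ the six refereed theorems ∧ «for every square-free `n` with
`rank E_n(ℚ) = 1` and `#Ш(E_n)[2^∞] < ∞`, `1 ≤ rank_Λ 𝐇¹_Γ(T₂E_n)` at the cyclotomic `ℤ₂`-pins» ∧ `PRFormulaAtTwoH2` —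
the fact `Kato2004.one_le_rank_iwasawaH1` asked only where the road consumes it; pin by pin the two currencies agree
(`Kato2004.nontrivial_iwasawaH1_iff_one_le_rank`, p517993), so this is `cruxB_of_refereed_of_nontrivialH1_rankOne_…`
re-keyed. CONDITIONAL; closes nothing. [cite: Kato2004Asterisque, §12.2 (12.2.2) (p. 220), Thm. 12.4 (2) (p. 221), §14.14 (p. 243)]
[cite: AlpogeBhargavaShnidman2022, App. A Thm. 10.1, Thm. 10.8, §10.1.3 (pp. 33–34)] -/
theorem cruxB_of_refereed_of_oneLeRank_rankOne_of_prFormulaH2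
    (hpar : ∀ (W : WeierstrassCurve ℚ) [W.IsElliptic] (p : ℕ) [Fact p.Prime], p_parity W p)
    (hmod : ModularForms.exists_isNewformOf) (hHL : HoffsteinLuo1997_exists_twist_L_one_ne_zero)
    (hKato : ∀ (W : WeierstrassCurve ℚ) [W.IsElliptic] (p : ℕ) [Fact p.Prime],
      kato_finite_of_L_one_ne_zero W p)
    (hHP : ∀ (W : WeierstrassCurve ℚ) (K : Type) [Field K] [NumberField K],
      exists_isHeegnerPoint W K)
    (hGZ : ∀ (W : WeierstrassCurve ℚ) (N : ℕ) [NeZero N] (K : Type) [Field K] [NumberField K],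
      analyticRankEK_eq_one_iff_heegner_nonTorsion W N K)
    (h1 : ∀ ⦃n : ℕ⦄, Squarefree n →
      ∀ [(congruentNumberCurve n).IsElliptic] [ContinuousSMul ℤ_[2] ((congruentNumberCurve n).tateModule 2)]
        (κ : ZpExtension ℚ 2) (γ : absoluteGaloisGroup ℚ), κ.IsCyclotomic → κ.IsTopGenerator γ →
        ∀ I : IwasawaH1Data (congruentNumberCurve n) 2 κ γ,
          (congruentNumberCurve n).mordellWeilRank = 1 →
            Finite (AddCommGroup.primaryComponent (congruentNumberCurve n).sha 2) →
              1 ≤ Module.rank (IwasawaAlgebra 2) I.H)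
    (hPR : PRFormulaAtTwoH2) :
    AnalyticRankOneOfRankOneFiniteShaTwo :=
  cruxB_of_refereed_of_nontrivialH1_rankOne_of_prFormulaH2 hpar hmod hHL hKato hHP hGZ
    (fun _ hsq _ _ κ γ hκ hγ I hrank hsha ↦
      (nontrivial_iwasawaH1_iff_one_le_rank hγ I).mpr (h1 hsq κ γ hκ hγ I hrank hsha)) hPR

end Summit.BirchSwinnertonDyer.BirchSwinnertonDyer.Theorems.CongruentShaFreeCutKatoZetaRoadNontrivialH1

end
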